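import Literature.AlgebraicGeometry.CossartPiltant200819.GoodResolutionOneBlowupQuasiExcellent2019
import Literature.AlgebraicGeometry.Resolution.ArithmeticalThreefoldsBlowupFormDimThree
import Literature.AlgebraicGeometry.Resolution.RegularBlowup
import Literature.AlgebraicGeometry.Resolution.RegularLocusDense
import Literature.AlgebraicGeometry.Resolution.KollarBlowupSequenceFunctors
import Literature.AlgebraicGeometry.Resolution.SncSaturatedCentre
import HarnessLib

/-!
# PRODUCT-COMPATIBLE one-blowing-up resolution of a quasi-excellent threefold: `Bl_{J · 𝔟} S` regular for a GIVEN `J`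
# (crux `FInjectiveMacaulayfication` stmt-ResolutionOfSingularities-15315, chain w45a; res-L1-w45a-plan-1 RULING R16.43 (b)
# `exists_productCompatible_locFix_lowDim`, scheme-level half (b1); seat res-L1-w45a-stub-1 g6)

[OURS · L1 W4.5a] Support file (`--supports stmt-ResolutionOfSingularities-15315 --as helper`); NOT a statement of any manuscript; def-free;
a THEOREM modulo three printed results taken BY NAME as hypotheses (`CossartPiltant2019General` = CP 2019 Thm. 1.1 (i)(ii);
`Stacks081R` = Raynaud–Gruson 1971 Thm. 5.2.2; `CossartPiltant2019Principalization` = CP 2019 Prop. 4.4); AI-written (AI review is weaker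
than expert review).

THE THEOREM `exists_isBlowup_mul_isRegular_of_dim_three (hG) (h081R) (hP)`: `S` an integral Noetherian separated quasi-excellent scheme of
dimension `3` (e.g. a threefold over a field, or `Spec 𝒪_{X,ζ}` at a point of local dimension `3` of a variety) and `J ≠ ⊥` ANY ideal sheaf
on `S`. Then there is an ideal sheaf `𝔟 ≠ ⊥` such that the blowing up of `S` along the PRODUCT `J · 𝔟` exists and is REGULAR, and every
blowing up along `J · 𝔟` is regular. WHY (plan-1 R16.43): a cure of the form `J · 𝔟` EQUALS `J` wherever `𝔟` is a unit — it improves a given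
partial cure `J` near a residual point without disturbing it elsewhere (the «dominating local fix»; consumer
`DominatingLocFix.exists_dominating_goodOver_nhd`).

PROOF. (1) The tree's one-blowing-up resolution `ρ : T = Bl_𝓛 S → S` (`CP2019.exists_isBlowup_isRegular_of_dim_three_of_isQuasiExcellent`,
from the three named facts): `T` regular, `ρ` an isomorphism over `Reg S ∋ ξ` (the generic point; `ξ ∉ supp J` since `J_ξ ≠ 0` in the
function field). (2) `T` is a regular excellent threefold (`isExcellent_of_isRegular_of_isQuasiExcellent`; `dim T = dim S` by proper
birationality) and `J𝒪_T ≠ 0`, so CP Prop. 4.4 principalizes it: `σ : T′ → T` a sequence of blowing ups in regular centres inside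
`V(J𝒪)`, `T′` regular (`IsRegularCentreBlowupSeq.isRegular`), `J𝒪_{T′}` invertible (`IsLocallyPrincipal.isEffectiveCartier_of_ne_bot`).
(3) `σ` is one blowing up along some `𝓚` (`IsRegularCentreBlowupSeq.exists_isBlowup_supported`), so `σ ≫ ρ` is one blowing up of `S` along
some `Q` supported off `ξ` (Stacks 080B, `IsBlowup.exists_isBlowup_comp_supported`), whence `Q ≠ ⊥`. (4) Blowing up in a product (Stacks 080A,
`IsBlowup.comp`) with the identity blowing up of the Cartier `J𝒪_{T′}` (`IsBlowup.id`): `σ ≫ ρ` is also THE blowing up along `Q · J = J · Q`;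
any other is isomorphic to `T′` (`IsBlowup.unique`), hence regular.
[cite: CossartPiltant2019, Thm. 1.1 (i)(ii); Prop. 4.4] [cite: StacksProject, Tag 080A; Tag 080B; Tag 081R] [cite: RaynaudGruson1971, Thm. 5.2.2]
-/

-- single-problem summit: the doubled namespace component is forced
set_option linter.dupNamespace false

noncomputable section

namespace Summit.ResolutionOfSingularities.ResolutionOfSingularities.Theorems.FInjectiveMacaulayfication.DominatingLocFixRegular

open CategoryTheory CategoryTheory.Limits AlgebraicGeometry TopologicalSpace IsLocalRing
open Literature.AlgebraicGeometry.Resolution Literature.AlgebraicGeometry.CossartPiltant200819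
open Scheme.IdealSheafData

universe u

/-- **Product-compatible one-blowing-up resolution of a quasi-excellent threefold.** For an integral Noetherian separated quasi-excellent
scheme `S` of dimension `3` and ANY ideal sheaf `J ≠ ⊥` on `S` there is `𝔟 ≠ ⊥` such that a blowing up of `S` along `J · 𝔟` exists and is
regular, and every blowing up along `J · 𝔟` is regular — modulo CP 2019 Thm. 1.1, Raynaud–Gruson flattening and CP 2019 Prop. 4.4 BY NAME.
[OURS · conditional-result] [cite: CossartPiltant2019, Thm. 1.1 (i)(ii); Prop. 4.4] [cite: StacksProject, Tag 080A; Tag 080B] -/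
theorem exists_isBlowup_mul_isRegular_of_dim_three
    (hG : CossartPiltant2019General.{u}) (h081R : Stacks081R.{u}) (hP : CossartPiltant2019Principalization.{u})
    {S : Scheme.{u}} [IsIntegral S] [IsNoetherian S] [S.IsSeparated]
    (hqe : Scheme.IsQuasiExcellent S) (hdim : topologicalKrullDim S = 3)
    (J : S.IdealSheafData) (hJ : J ≠ ⊥) :
    ∃ 𝔟 : S.IdealSheafData, 𝔟 ≠ ⊥ ∧ (∃ (T : Scheme.{u}) (π : T ⟶ S), IsBlowup π (J * 𝔟) ∧ Scheme.IsRegular T) ∧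
      ∀ (T : Scheme.{u}) (π : T ⟶ S), IsBlowup π (J * 𝔟) → Scheme.IsRegular T := by
  classical
  -- (1) the one-blowing-up resolution `ρ : T → S` along `𝓛`, an isomorphism over `U = Reg S`
  obtain ⟨𝓛, T, ρ, h𝓛, hρ, hTreg, U, hU, h𝓛U, hisoU⟩ :=
    CP2019.exists_isBlowup_isRegular_of_dim_three_of_isQuasiExcellent hG h081R hP hqe hdim
  haveI := hisoU
  haveI : IsProper ρ := hρ.isProper
  haveI : IsIntegral T := hρ.isIntegral h𝓛
  haveI : IsNoetherian T := by
    haveI : IsLocallyNoetherian T := LocallyOfFiniteType.isLocallyNoetherian ρ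
    haveI : CompactSpace T := QuasiCompact.compactSpace_of_compactSpace ρ
    exact {}
  -- the generic point `ξ` is regular and lies off `supp J` (`J_ξ ≠ 0` is an ideal of the function field, so `J_ξ = ⊤`)
  have hξU : genericPoint S ∈ (U : Set S) := by
    rw [hU, Scheme.mem_regularLocus]
    exact inferInstanceAs (IsRegularLocalRing S.functionField)
  have hξJ : genericPoint S ∉ (J.support : Set S) := by
    intro hmem
    have hne : stalkIdeal J (genericPoint S) ≠ ⊤ := (mem_support_iff_stalkIdeal_ne_top J _).mp hmem
    have hnb : stalkIdeal J (genericPoint S) ≠ ⊥ := stalkIdeal_ne_bot_of_ne_bot hJ _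
    have key : ∀ I : Ideal S.functionField, I = ⊥ ∨ I = ⊤ := fun I => Ideal.eq_bot_or_top I
    rcases key (stalkIdeal J (genericPoint S)) with h | h
    · exact hnb h
    · exact hne h
  -- a point `x′ ∈ T` over `ξ`
  obtain ⟨x', hx'⟩ := (ConcreteCategory.bijective_of_isIso (ρ ∣_ U).base).2 ⟨genericPoint S, hξU⟩
  have hρx' : ρ x'.1 = genericPoint S := by
    have h1 := congrArg Subtype.val hx'
    rwa [morphismRestrict_base_coe] at h1
  -- `J𝒪_T ≠ 0`
  have hJT : J.comap ρ ≠ ⊥ := by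
    intro h0
    have hmem : x'.1 ∈ ((J.comap ρ).support : Set T) := by rw [h0, support_bot]; trivial
    rw [support_comap] at hmem
    have hmem' : ρ x'.1 ∈ (J.support : Set S) := hmem
    rw [hρx'] at hmem'
    exact hξJ hmem'
  -- (2) `T` is a regular excellent threefold; principalize `J𝒪_T` (CP Prop. 4.4)
  have hexc : Scheme.IsExcellent T :=
    CP2019.isExcellent_of_isRegular_of_isQuasiExcellent hTreg (Scheme.IsQuasiExcellent.of_locallyOfFiniteType ρ hqe)
  have hbir : IsBirational ρ := by
    refine isBirational_of_isIso_restrict ρ U (by rw [hU]) ?_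
    refine (ρ ⁻¹ᵁ U).isOpen.dense ⟨x'.1, ?_⟩
    show ρ x'.1 ∈ (U : Set S)
    rw [hρx']
    exact hξU
  have hdimT : topologicalKrullDim T = 3 := hbir.topologicalKrullDim_eq_of_isProper.trans hdim
  obtain ⟨T', σ, hseq, hprinc⟩ := hP T hTreg hexc hdimT (J.comap ρ) hJT
  haveI : IsIntegral T' := hseq.isIntegral hJT
  have hT'reg : Scheme.IsRegular T' := hseq.isRegular hTreg
  have hcart : IsEffectiveCartier (J.comap (σ ≫ ρ)) := by
    rw [comap_comp]
    exact hprinc.isEffectiveCartier_of_ne_bot (hseq.isIntegral_and_comap_ne_bot inferInstance inferInstance hJT).2.2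
  -- (3) `σ` is one blowing up along some `𝓚 ⊆ V(J𝒪_T)`; `σ ≫ ρ` is one blowing up of `S` along some `Q` supported off `ξ`
  obtain ⟨𝓚, h𝓚, h𝓚supp⟩ := hseq.exists_isBlowup_supported inferInstance
  have h𝓛C : (𝓛.support : Set S) ⊆ ({genericPoint S}ᶜ : Set S) := by
    intro x hx hxξ
    rw [Set.mem_singleton_iff] at hxξ
    rw [hxξ] at hx
    exact h𝓛U hx hξU
  have h𝓚C : (𝓚.support : Set T) ⊆ ρ ⁻¹' ({genericPoint S}ᶜ : Set S) := by
    intro y hy hyξ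
    have hyξ' : ρ y = genericPoint S := hyξ
    have hy' : y ∈ ((J.comap ρ).support : Set T) := h𝓚supp hy
    rw [support_comap] at hy'
    have hy'' : ρ y ∈ (J.support : Set S) := hy'
    rw [hyξ'] at hy''
    exact hξJ hy''
  obtain ⟨Q, hQ, hQsupp⟩ :=
    IsBlowup.exists_isBlowup_comp_supported ρ 𝓛 σ 𝓚 ({genericPoint S}ᶜ : Set S) hρ h𝓛C h𝓚 h𝓚C
  have hQ0 : Q ≠ ⊥ := by
    intro h0
    have hmem : genericPoint S ∈ (Q.support : Set S) := by rw [h0, support_bot]; trivial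
    exact hQsupp hmem (Set.mem_singleton _)
  -- (4) `J𝒪_{T′}` is Cartier, so `σ ≫ ρ` is also THE blowing up along `Q · J = J · Q` (Stacks 080A with the identity blowing up)
  have hfin : IsBlowup (σ ≫ ρ) (J * Q) := by
    have h := hQ.comp (IsBlowup.id hcart)
    rw [Category.id_comp, mul_comm] at h
    exact h
  refine ⟨Q, hQ0, ⟨T', σ ≫ ρ, hfin, hT'reg⟩, fun T'' π'' hπ'' => ?_⟩
  obtain ⟨e, -, -⟩ := hfin.unique hπ''
  exact hT'reg.of_iso e.hom

end Summit.ResolutionOfSingularities.ResolutionOfSingularities.Theorems.FInjectiveMacaulayfication.DominatingLocFixRegular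

end
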